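import Summits.QuantumFields.BalabanUV.Beta.EriceRemainderEnclosureHistoryAutonomyComparisonTowerChainFourLemmas

/-!
# EriceRemainderEnclosureHistoryAutonomyComparisonTowerRefinedBudget — (E67f) THE REFINED BUDGET LINE: at a non-minimal age `k` with predecessor `p` and
# pre-predecessor `p′ = pred p`, the window budget of (E65a) at the scale `k` gives **`x_k·S_{k,k}∕k + ρ₁·x_p + ρ₂·Z_{p′} ≤ 1∕2`** with the NEAREST neighbour
# credited at `ρ₁ = 2√p∕(√(p+k+1) + √(p+1))` and all OLDER young ages at the larger rate `ρ₂ = 2√p′∕(√(p′+k+1) + √(p′+1))` per unit of `Z_{p′} =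
# Σ_{s≤p′} x_s√(s∕p′)` ((E65i)'s telescoping, read twice).  (E66a)∕(E67b) credit everything at the nearest rate; the numerics of this generation (README
# `g59/e66`, `r3twostep*.py`) show that this refinement — and, as far as the relaxations tried go, only this refinement — closes the dual chain on towers of
# ratio `3` (two-step closure of the defect invariant `e ≤ g·u∕(1 − a·u)`, margins `0.01` lattice ∕ `0.08` asymptotic); this file is the budget half of that
# station, stated without any ratio hypothesis

Cell `pub-balaban`, β-function sub-cell, BINDER row D4 «RemainderConst leaves for Bałaban's split» (`HOME/BINDER-OWNERS.md`; owner lineage `b2b-balaban-beta-an4`;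
this file by co-owner #2 lineage `b2b-balaban-beta-d4-p2`, generation 59), β-FLOW TEAM duty (1), FREEZE (0) honoured (def-free; (E65a) `readWindow_nonneg`, (E65i)
`readWindow_ge_telescope` BY NAME).

HONEST FRAMING (page 1, verbatim and binding).  *"Discharging BetaPertH makes Bałaban's UV stability UNCONDITIONAL — a real constructive-QFT result; it is
NOT the continuum limit and NOT the Clay problem."*  THIS FILE DISCHARGES NOTHING OF THE KIND.  A lemma about finitely many non-negative reals; nothing of
Bałaban's is asserted.  Row D4 class UNCHANGED (critical-path width 0; instance 0∕1; D4 DISCHARGE NO DATE).  HONEST DEPENDENCY: continuum YM on T⁴ ⇐ BetaPertH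
∧ nine spine estimates (0/9 proved); BetaPertH ⇐ (D1) ∧ (D4) ∧ CAP+tail; G-an2-4 gates asym, D1 and NE2/3/4.

WHAT IS PROVED ([folklore]; 0 `def`, 0 sorry).  `young_read_ge` (one young age's read, telescoped at a reference age), **`refined_line_at`**.
-/
noncomputable section
open Finset

namespace Summit.QuantumFields.BalabanUV.Beta.EriceRemainderEnclosureHistoryAutonomyComparisonTowerRefinedBudget

open Summit.QuantumFields.BalabanUV.Beta.EriceRemainderEnclosureHistoryAutonomyComparisonLoadBudgetWindow (readWindow_nonneg)
open Summit.QuantumFields.BalabanUV.Beta.EriceRemainderEnclosureHistoryAutonomyComparisonTowerChainSix (readWindow_ge_telescope)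

/-- **ONE YOUNG AGE'S READ, TELESCOPED AT A REFERENCE AGE**: for `1 ≤ s ≤ q` and `k ≥ 1`,
`x·(2√q∕(√(q+k+1) + √(q+1)))·√(s∕q) ≤ x·S_{s,k}∕k` for `x ≥ 0` (`S_{s,k} = Σ_{l<k}√(s∕(s+l+1)) ≥ 2√s(√(s+k+1) − √(s+1))`, then the denominators at `q ≥ s`).
[folklore] -/
theorem young_read_ge {s q k : ℕ} {x : ℝ} (hs : 1 ≤ s) (hsq : s ≤ q) (hk : 1 ≤ k) (hx : 0 ≤ x) :
    2 * Real.sqrt (q : ℝ) / (Real.sqrt ((q : ℝ) + k + 1) + Real.sqrt ((q : ℝ) + 1)) * (x * Real.sqrt ((s : ℝ) / q)) ≤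
      x * ((∑ l ∈ range k, Real.sqrt ((s : ℝ) / ((s : ℝ) + l + 1))) / k) := by
  have hs1 : (0 : ℝ) < s := by exact_mod_cast hs
  have hq1 : (0 : ℝ) < q := by exact_mod_cast (hs.trans hsq)
  have hkr : (0 : ℝ) < k := by exact_mod_cast hk
  have hsq' : (s : ℝ) ≤ q := by exact_mod_cast hsq
  have htel := readWindow_ge_telescope hs1 k
  have hposs : 0 < Real.sqrt ((s : ℝ) + k + 1) + Real.sqrt ((s : ℝ) + 1) := by positivity
  have hdiff : Real.sqrt ((s : ℝ) + k + 1) - Real.sqrt ((s : ℝ) + 1) = k / (Real.sqrt ((s : ℝ) + k + 1) + Real.sqrt ((s : ℝ) + 1)) := by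
    have e1 : Real.sqrt ((s : ℝ) + k + 1) * Real.sqrt ((s : ℝ) + k + 1) = (s : ℝ) + k + 1 := Real.mul_self_sqrt (by positivity)
    have e2 : Real.sqrt ((s : ℝ) + 1) * Real.sqrt ((s : ℝ) + 1) = (s : ℝ) + 1 := Real.mul_self_sqrt (by positivity)
    have hab : (Real.sqrt ((s : ℝ) + k + 1) - Real.sqrt ((s : ℝ) + 1)) * (Real.sqrt ((s : ℝ) + k + 1) + Real.sqrt ((s : ℝ) + 1)) = k := by
      nlinarith [e1, e2]
    rw [eq_div_iff hposs.ne']; exact hab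
  have hdens : Real.sqrt ((s : ℝ) + k + 1) + Real.sqrt ((s : ℝ) + 1) ≤ Real.sqrt ((q : ℝ) + k + 1) + Real.sqrt ((q : ℝ) + 1) :=
    add_le_add (Real.sqrt_le_sqrt (by linarith)) (Real.sqrt_le_sqrt (by linarith))
  have hW : 2 * Real.sqrt (s : ℝ) / (Real.sqrt ((q : ℝ) + k + 1) + Real.sqrt ((q : ℝ) + 1)) ≤
      (∑ l ∈ range k, Real.sqrt ((s : ℝ) / ((s : ℝ) + l + 1))) / k := by
    rw [le_div_iff₀ hkr]
    calc 2 * Real.sqrt (s : ℝ) / (Real.sqrt ((q : ℝ) + k + 1) + Real.sqrt ((q : ℝ) + 1)) * k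
        ≤ 2 * Real.sqrt (s : ℝ) / (Real.sqrt ((s : ℝ) + k + 1) + Real.sqrt ((s : ℝ) + 1)) * k := by
          apply mul_le_mul_of_nonneg_right _ hkr.le
          exact div_le_div_of_nonneg_left (by positivity) hposs hdens
      _ = 2 * Real.sqrt (s : ℝ) * (Real.sqrt ((s : ℝ) + k + 1) - Real.sqrt ((s : ℝ) + 1)) := by rw [hdiff]; field_simp
      _ ≤ ∑ l ∈ range k, Real.sqrt ((s : ℝ) / ((s : ℝ) + l + 1)) := htel
  have hsq : Real.sqrt (s : ℝ) = Real.sqrt (q : ℝ) * Real.sqrt ((s : ℝ) / q) := by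
    rw [← Real.sqrt_mul (by positivity)]; congr 1; field_simp
  calc 2 * Real.sqrt (q : ℝ) / (Real.sqrt ((q : ℝ) + k + 1) + Real.sqrt ((q : ℝ) + 1)) * (x * Real.sqrt ((s : ℝ) / q))
      = x * (2 * Real.sqrt (s : ℝ) / (Real.sqrt ((q : ℝ) + k + 1) + Real.sqrt ((q : ℝ) + 1))) := by rw [hsq]; ring
    _ ≤ x * ((∑ l ∈ range k, Real.sqrt ((s : ℝ) / ((s : ℝ) + l + 1))) / k) := mul_le_mul_of_nonneg_left hW hx

/-- **THE REFINED BUDGET LINE.**  `A` a finite set of ages `≥ 1` with minimum `m₀` and predecessor map `pred`; loads `x ≥ 0` obeying the window budget of (E65a)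
at the scales `j = k ∈ A`; `k ∈ A` with `p = pred k ≠ m₀` and `p′ = pred p` (so `k` has at least two younger ages).  Then
**`x_k·S_{k,k}∕k + ρ₁·x_p + ρ₂·Z_{p′} ≤ 1∕2`**, `ρ₁ = 2√p∕(√(p+k+1) + √(p+1))`, `ρ₂ = 2√p′∕(√(p′+k+1) + √(p′+1))` (`> ρ₁`: the OLDER young ages are credited at
the larger far-field rate), `Z_{p′} = Σ_{s∈A, s≤p′} x_s√(s∕p′)`.  No ratio hypothesis; the consumers bound `S_{k,k}∕k`, `ρ₁`, `ρ₂` under theirs. [folklore] -/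
theorem refined_line_at {A : Finset ℕ} {x : ℕ → ℝ} {pred : ℕ → ℕ} {m₀ : ℕ}
    (hA1 : ∀ k ∈ A, 1 ≤ k) (hx : ∀ k ∈ A, 0 ≤ x k)
    (hpred : ∀ k ∈ A, k ≠ m₀ → pred k ∈ A ∧ pred k < k ∧ ∀ k'' ∈ A, k'' < k → k'' ≤ pred k)
    (hbud : ∀ k ∈ A, ∑ s ∈ A, x s * (if s ≤ k then (∑ l ∈ range k, Real.sqrt ((s : ℝ) / ((s : ℝ) + l + 1))) / k
        else (∑ l ∈ range k, Real.sqrt ((s : ℝ) / ((s : ℝ) + l + 1))) / s) ≤ 1 / 2)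
    {k : ℕ} (hk : k ∈ A) (hne : k ≠ m₀) (hpne : pred k ≠ m₀) :
    x k * ((∑ l ∈ range k, Real.sqrt ((k : ℝ) / ((k : ℝ) + l + 1))) / k) +
      2 * Real.sqrt (pred k : ℝ) / (Real.sqrt ((pred k : ℝ) + k + 1) + Real.sqrt ((pred k : ℝ) + 1)) * x (pred k) +
      2 * Real.sqrt (pred (pred k) : ℝ) / (Real.sqrt ((pred (pred k) : ℝ) + k + 1) + Real.sqrt ((pred (pred k) : ℝ) + 1)) *
        (∑ s ∈ A.filter (fun s => s ≤ pred (pred k)), x s * Real.sqrt ((s : ℝ) / pred (pred k))) ≤ 1 / 2 := by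
  have hW0 : ∀ k s : ℕ, 0 ≤ (if s ≤ k then (∑ l ∈ range k, Real.sqrt ((s : ℝ) / ((s : ℝ) + l + 1))) / k
      else (∑ l ∈ range k, Real.sqrt ((s : ℝ) / ((s : ℝ) + l + 1))) / s) := fun k s => by
    have := readWindow_nonneg s k; split_ifs <;> positivity
  obtain ⟨hpA, hplt, hpmax⟩ := hpred k hk hne
  obtain ⟨hppA, hpplt, hppmax⟩ := hpred (pred k) hpA hpne
  have hk1 : 1 ≤ k := hA1 k hk
  -- ages ≤ k: {k} ∪ {pred k} ∪ {s ≤ pred (pred k)}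
  have hset_le : A.filter (fun s => s ≤ k) = insert k (insert (pred k) (A.filter (fun s => s ≤ pred (pred k)))) := by
    ext s; simp only [mem_filter, mem_insert]
    constructor
    · rintro ⟨hs, hsk⟩
      rcases lt_or_eq_of_le hsk with h | h
      · have hsp := hpmax s hs h
        rcases lt_or_eq_of_le hsp with h2 | h2
        · exact Or.inr (Or.inr ⟨hs, hppmax s hs h2⟩)
        · exact Or.inr (Or.inl h2)
      · exact Or.inl h
    · rintro (rfl | rfl | ⟨hs, hsp⟩)
      · exact ⟨hk, le_rfl⟩
      · exact ⟨hpA, hplt.le⟩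
      · exact ⟨hs, (hsp.trans hpplt.le).trans hplt.le⟩
  have hnot1 : k ∉ insert (pred k) (A.filter (fun s => s ≤ pred (pred k))) := by
    simp only [mem_insert, mem_filter, not_or, not_and, not_le]
    exact ⟨(ne_of_lt hplt).symm, fun _ => hpplt.trans hplt⟩
  have hnot2 : pred k ∉ A.filter (fun s => s ≤ pred (pred k)) := by
    simp only [mem_filter, not_and, not_le]; exact fun _ => hpplt
  have hb := hbud k hk
  have hdrop : ∑ s ∈ A.filter (fun s => s ≤ k), x s * ((∑ l ∈ range k, Real.sqrt ((s : ℝ) / ((s : ℝ) + l + 1))) / k) ≤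
      ∑ s ∈ A, x s * (if s ≤ k then (∑ l ∈ range k, Real.sqrt ((s : ℝ) / ((s : ℝ) + l + 1))) / k
        else (∑ l ∈ range k, Real.sqrt ((s : ℝ) / ((s : ℝ) + l + 1))) / s) := by
    calc ∑ s ∈ A.filter (fun s => s ≤ k), x s * ((∑ l ∈ range k, Real.sqrt ((s : ℝ) / ((s : ℝ) + l + 1))) / k)
        = ∑ s ∈ A.filter (fun s => s ≤ k), x s * (if s ≤ k then (∑ l ∈ range k, Real.sqrt ((s : ℝ) / ((s : ℝ) + l + 1))) / k
            else (∑ l ∈ range k, Real.sqrt ((s : ℝ) / ((s : ℝ) + l + 1))) / s) :=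
          sum_congr rfl fun s hs => by rw [if_pos (mem_filter.mp hs).2]
      _ ≤ _ := sum_le_sum_of_subset_of_nonneg (filter_subset _ A) fun s hs _ => mul_nonneg (hx s hs) (hW0 k s)
  rw [hset_le, sum_insert hnot1, sum_insert hnot2] at hdrop
  -- nearest neighbour: s = pred k at reference q = pred k
  have h1 := young_read_ge (x := x (pred k)) (hA1 _ hpA) le_rfl hk1 (hx _ hpA)
  have hpr : (0 : ℝ) < pred k := by exact_mod_cast hA1 _ hpA
  rw [div_self hpr.ne', Real.sqrt_one, mul_one] at h1
  -- older ages: reference q = pred (pred k)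
  have h2 : 2 * Real.sqrt (pred (pred k) : ℝ) / (Real.sqrt ((pred (pred k) : ℝ) + k + 1) + Real.sqrt ((pred (pred k) : ℝ) + 1)) *
      (∑ s ∈ A.filter (fun s => s ≤ pred (pred k)), x s * Real.sqrt ((s : ℝ) / pred (pred k))) ≤
      ∑ s ∈ A.filter (fun s => s ≤ pred (pred k)), x s * ((∑ l ∈ range k, Real.sqrt ((s : ℝ) / ((s : ℝ) + l + 1))) / k) := by
    rw [mul_sum]
    exact sum_le_sum fun s hs => young_read_ge (hA1 s (mem_filter.mp hs).1) (mem_filter.mp hs).2 hk1 (hx s (mem_filter.mp hs).1)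
  linarith [hdrop.trans hb]

end Summit.QuantumFields.BalabanUV.Beta.EriceRemainderEnclosureHistoryAutonomyComparisonTowerRefinedBudget

end
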